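import Literature.NumberTheory.GaloisRepresentations.LiftingObstructionCoefficients
import Literature.NumberTheory.GaloisRepresentations.GaloisCohomology
import HarnessLib

/-!
# Adjoint coefficient representations `ad ρ̄ ⊇ 𝔭_b` and entrywise coefficient maps

Topic `Literature/NumberTheory/GaloisRepresentations`.  The fixed coefficient representations
over a (discrete) residue ring `κ` that receive Mazur's obstruction classes
(`LiftingObstructionCoefficients.obstructionClassIn`), and the coefficient maps into them:

* `adRep r` — for `r : G → GL_n(κ)` with open kernel, the continuous representation of `G` on
  `M_n(κ)` by conjugation (`ad r`), and for a `P_b(κ)`-valued `r` the subrepresentation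
  `adParabolicRep` on the parabolic Lie algebra `𝔭_b(κ)` (block-upper-triangular matrices,
  `parabolicLie b κ`), with the inclusion `parabolicInclHom : 𝔭_b → ad`;
* `kernelEntrywise Λ` — for a function `Λ : B → κ` which is ADDITIVE on `I = ker φ` and
  `res`-SEMILINEAR there (`Λ(a x c) = res(a) Λ(x) res(c)` for `x ∈ I`; in the application
  `Λ = u ∘ (I ≅ J/𝔪J)` for a functional `u`), the entrywise map `𝔭_b(I) → 𝔭_b(κ)`; it is
  conjugation-EQUIVARIANT (`isConjEquivariant_kernelEntrywise`) as soon as the section `s` reduces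
  to `r` (`GL_n(res) ∘ s ∘ ρ = r`), by the matrix identity `Λ(P X Q) = res(P) Λ(X) res(Q)`
  (`map_mul_mul_of_kernelAdditive`).

These are the inputs `Y`, `e` of `obstructionClassIn` for the global (`b` constant, `Y = ad ρ̄`)
and local Borel (`b = id`, `Y = 𝔟`) obstruction classes in the relation count for nearly
ordinary deformation rings (Böckle 2007, Thm. 7.6).  Everything is proved; no named facts.

## References

* B. Mazur, *Deforming Galois representations*, MSRI Publ. 16 (1989), §1.2 (`Ad ρ̄`), §1.6.
  [cite: Mazur1989Deforming, §1.6 Prop. 2]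
* G. Böckle, *Presentations of universal deformation rings*, LMS LNS 320 (2007), §5, Thm. 7.6.
  [cite: Bockle2007Presentations, Theorem 7.6]
-/

noncomputable section

open Topology Filter

namespace Literature.NumberTheory.GaloisRepresentations

namespace LiftingObstruction

open Matrix

universe v

/-! ## 1. The adjoint representation on `M_n(κ)` -/

section Ad

variable {n : Type} [Fintype n] [DecidableEq n] {κ : Type v} [CommRing κ] [TopologicalSpace κ]
  [DiscreteTopology κ] {G : Type v} [Group G] [TopologicalSpace G] [IsTopologicalGroup G]
  (r : G →* GL n κ) (hr : IsOpen ((r.ker : Subgroup G) : Set G))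

omit [TopologicalSpace κ] [DiscreteTopology κ] in
/-- Conjugation `X ↦ g X g⁻¹` by `g ∈ GL_n(κ)` as a `κ`-linear map. [folklore] -/
def conjLin (g : GL n κ) : Matrix n n κ →ₗ[κ] Matrix n n κ where
  toFun X := (g : Matrix n n κ) * X * ((g⁻¹ : GL n κ) : Matrix n n κ)
  map_add' X Y := by rw [mul_add, add_mul]
  map_smul' c X := by rw [RingHom.id_apply, Matrix.mul_smul, Matrix.smul_mul]

omit [TopologicalSpace κ] [DiscreteTopology κ] in
/-- Unfolding `conjLin`. [folklore] -/
@[simp] theorem conjLin_apply (g : GL n κ) (X : Matrix n n κ) :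
    conjLin g X = (g : Matrix n n κ) * X * ((g⁻¹ : GL n κ) : Matrix n n κ) :=
  rfl

omit [TopologicalSpace κ] [DiscreteTopology κ] [TopologicalSpace G] [IsTopologicalGroup G] in
/-- **The adjoint representation** `ad r : σ ↦ (X ↦ r(σ) X r(σ)⁻¹)` on `M_n(κ)`.
[cite: Mazur1989Deforming, §1.6 Prop. 2] -/
def adRepresentation : Representation κ G (Matrix n n κ) where
  toFun σ := conjLin (r σ)
  map_one' := by
    refine LinearMap.ext fun X => ?_
    simp
  map_mul' σ τ := by
    refine LinearMap.ext fun X => ?_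
    simp only [conjLin_apply, map_mul, _root_.mul_inv_rev, Units.val_mul, Module.End.mul_apply]
    noncomm_ring

omit [TopologicalSpace κ] [DiscreteTopology κ] [TopologicalSpace G] [IsTopologicalGroup G] in
/-- Unfolding `adRepresentation`. [folklore] -/
@[simp] theorem adRepresentation_apply (σ : G) (X : Matrix n n κ) :
    adRepresentation r σ X = (r σ : Matrix n n κ) * X * (((r σ)⁻¹ : GL n κ) : Matrix n n κ) :=
  rfl

/-- **`ad r` as a continuous representation** on the discrete module `M_n(κ)` (stabilisers
contain the open kernel of `r`). [cite: Mazur1989Deforming, §1.6 Prop. 2] -/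
def adRep : ContinuousRep G κ (Matrix n n κ) :=
  ContinuousRep.ofStabilizerMemNhdsOne (adRepresentation r) fun X => by
    refine Filter.mem_of_superset (hr.mem_nhds (by simp)) fun σ hσ => ?_
    rw [SetLike.mem_coe, MonoidHom.mem_ker] at hσ
    simp [hσ]

/-- Unfolding `adRep`. [folklore] -/
@[simp] theorem adRep_apply (σ : G) (X : Matrix n n κ) :
    adRep r hr σ X = (r σ : Matrix n n κ) * X * (((r σ)⁻¹ : GL n κ) : Matrix n n κ) :=
  rfl

/-! ## 2. The parabolic Lie subalgebra `𝔭_b(κ) ⊆ ad` -/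

variable {α : Type} [LinearOrder α] (b : n → α)

omit [TopologicalSpace κ] [DiscreteTopology κ] in
/-- The parabolic Lie algebra `𝔭_b(κ)`: block-upper-triangular matrices, as a submodule of
`M_n(κ)`. [cite: Mazur1989Deforming, §1.7] -/
def parabolicLie : Submodule κ (Matrix n n κ) :=
  Subalgebra.toSubmodule (Matrix.blockTriangularSubalgebra κ κ b)

omit [TopologicalSpace κ] [DiscreteTopology κ] in
variable {b} in
/-- Membership in `𝔭_b(κ)`. [folklore] -/
@[simp] theorem mem_parabolicLie_iff (X : Matrix n n κ) :
    X ∈ parabolicLie (κ := κ) b ↔ X.BlockTriangular b :=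
  Iff.rfl

variable (hrP : ∀ σ, r σ ∈ parabolicGL b κ)

omit [TopologicalSpace κ] [DiscreteTopology κ] [TopologicalSpace G] [IsTopologicalGroup G] in
include hrP in
/-- `𝔭_b(κ)` is stable under `ad r` for a `P_b(κ)`-valued `r`. [cite: Mazur1989Deforming, §1.7] -/
theorem parabolicLie_le_comap (σ : G) :
    parabolicLie (κ := κ) b ≤ (parabolicLie (κ := κ) b).comap (adRepresentation r σ) := by
  intro X hX
  rw [Submodule.mem_comap, mem_parabolicLie_iff, adRepresentation_apply]
  rw [mem_parabolicLie_iff] at hX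
  exact ((hrP σ).mul hX).mul ((parabolicGL b κ).inv_mem (hrP σ))

/-- **`𝔭_b ⊆ ad r` as a continuous subrepresentation.** [cite: Mazur1989Deforming, §1.7] -/
def adParabolicRep : ContinuousRep G κ (parabolicLie (κ := κ) b) :=
  (adRep r hr).subrepresentation (parabolicLie (κ := κ) b) (parabolicLie_le_comap r b hrP)

/-- Unfolding `adParabolicRep`. [folklore] -/
@[simp] theorem coe_adParabolicRep_apply (σ : G) (X : parabolicLie (κ := κ) b) :
    ((adParabolicRep r hr b hrP σ X : parabolicLie (κ := κ) b) : Matrix n n κ) =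
      (r σ : Matrix n n κ) * (X : Matrix n n κ) * (((r σ)⁻¹ : GL n κ) : Matrix n n κ) :=
  rfl

/-- The inclusion `𝔭_b → ad r` as a morphism of topological representations. [folklore] -/
def parabolicInclHom : (adParabolicRep r hr b hrP).toTopRep ⟶ (adRep r hr).toTopRep :=
  TopRep.ofHom
    { toLinearMap := (parabolicLie (κ := κ) b).subtype
      cont := continuous_subtype_val
      isIntertwining' := fun _ => rfl }

/-- `parabolicInclHom` on elements. [folklore] -/
@[simp] theorem parabolicInclHom_hom_apply (X : parabolicLie (κ := κ) b) :
    (parabolicInclHom r hr b hrP).hom X = (X : Matrix n n κ) :=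
  rfl

end Ad

/-! ## 3. Kernel-additive, `res`-semilinear functions and the entrywise coefficient maps -/

section Entrywise

variable {n : Type} [Fintype n] [DecidableEq n] {A B : Type v} [CommRing A] [CommRing B]
  {φ : B →+* A} {κ : Type v} [CommRing κ] (res : B →+* κ) (Λ : B → κ)

/-- `Λ : B → κ` is **kernel-additive and `res`-semilinear**: additive on `I = ker φ`, and
`Λ(a x c) = res(a) Λ(x) res(c)` for `x ∈ I` (in the application `Λ = u ∘ (I ≅ J/𝔪J)`, a
functional on `I`, extended by anything outside `I`). [folklore] -/
structure IsKernelSemilinear : Prop where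
  map_zero : Λ 0 = 0
  map_add : ∀ x y, x ∈ RingHom.ker φ → y ∈ RingHom.ker φ → Λ (x + y) = Λ x + Λ y
  map_mul_mul : ∀ a x c, x ∈ RingHom.ker φ → Λ (a * x * c) = res a * Λ x * res c

variable {res Λ}

/-- A kernel-additive function is additive over finite sums of kernel elements. [folklore] -/
theorem IsKernelSemilinear.map_finset_sum (hΛ : IsKernelSemilinear (φ := φ) res Λ) {ι : Type*}
    (t : Finset ι) (f : ι → B) (hf : ∀ i ∈ t, f i ∈ RingHom.ker φ) :
    Λ (∑ i ∈ t, f i) = ∑ i ∈ t, Λ (f i) := by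
  classical
  induction t using Finset.induction_on with
  | empty => simp [hΛ.map_zero]
  | insert a t ha ih =>
    rw [Finset.sum_insert ha, Finset.sum_insert ha,
      hΛ.map_add _ _ (hf a (Finset.mem_insert_self a t))
        (Ideal.sum_mem _ fun i hi => hf i (Finset.mem_insert_of_mem hi)),
      ih fun i hi => hf i (Finset.mem_insert_of_mem hi)]

/-- **Transfer along a surjection of extensions.**  If `g : B₀ ↠ B₁` is onto and compatible
with the maps to `A` (`φ₁ ∘ g = φ₀`), with the residue maps (`res₁ ∘ g = res₀`) and with the
functionals (`Λ₁ ∘ g = Λ₀`), then kernel-semilinearity of `Λ₀` passes to `Λ₁`. [folklore] -/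
theorem IsKernelSemilinear.of_comp_surjective {B₀ : Type v} [CommRing B₀] {φ₀ : B₀ →+* A}
    {res₀ : B₀ →+* κ} {Λ₀ : B₀ → κ} (h₀ : IsKernelSemilinear (φ := φ₀) res₀ Λ₀)
    (g : B₀ →+* B) (hg : Function.Surjective g) (hφ : ∀ x, φ (g x) = φ₀ x)
    (hres : ∀ x, res (g x) = res₀ x) (hΛg : ∀ x, Λ (g x) = Λ₀ x) :
    IsKernelSemilinear (φ := φ) res Λ := by
  have hker : ∀ x, g x ∈ RingHom.ker φ ↔ x ∈ RingHom.ker φ₀ := fun x => by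
    rw [RingHom.mem_ker, RingHom.mem_ker, hφ]
  refine ⟨?_, ?_, ?_⟩
  · rw [← _root_.map_zero g, hΛg, h₀.map_zero]
  · intro x y hx hy
    obtain ⟨x, rfl⟩ := hg x
    obtain ⟨y, rfl⟩ := hg y
    rw [← _root_.map_add, hΛg, hΛg, hΛg, h₀.map_add _ _ ((hker x).mp hx) ((hker y).mp hy)]
  · intro a x c hx
    obtain ⟨a, rfl⟩ := hg a
    obtain ⟨x, rfl⟩ := hg x
    obtain ⟨c, rfl⟩ := hg c
    rw [← _root_.map_mul, ← _root_.map_mul, hΛg, hΛg, hres, hres,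
      h₀.map_mul_mul _ _ _ ((hker x).mp hx)]

/-- **`Λ(P X Q) = res(P) Λ(X) res(Q)`** entrywise, for `X ∈ M_n(I)`. [folklore] -/
theorem map_mul_mul_of_kernelSemilinear (hΛ : IsKernelSemilinear (φ := φ) res Λ)
    (P Q : Matrix n n B) {X : Matrix n n B} (hX : X ∈ kerMatrix φ) :
    (P * X * Q).map Λ = P.map res * X.map Λ * Q.map res := by
  rw [mem_kerMatrix_iff] at hX
  have hXm : ∀ k l, X k l ∈ RingHom.ker φ := fun k l => (RingHom.mem_ker).mpr (hX k l)
  ext i j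
  simp only [Matrix.map_apply, Matrix.mul_apply, Finset.sum_mul]
  rw [hΛ.map_finset_sum _ _ fun l _ => Ideal.sum_mem _ fun k _ =>
      Ideal.mul_mem_right _ _ (Ideal.mul_mem_left _ _ (hXm k l))]
  refine Finset.sum_congr rfl fun l _ => ?_
  rw [hΛ.map_finset_sum _ _ fun k _ => Ideal.mul_mem_right _ _ (Ideal.mul_mem_left _ _ (hXm k l))]
  refine Finset.sum_congr rfl fun k _ => ?_
  exact hΛ.map_mul_mul _ _ _ (hXm k l)

variable {α : Type} [LinearOrder α] (b : n → α)

/-- **The entrywise coefficient map** `𝔭_b(I) → 𝔭_b(κ)`, `X ↦ (Λ(X_{ij}))`.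
[cite: Mazur1989Deforming, §1.6 Prop. 2] -/
def kernelEntrywise (hΛ : IsKernelSemilinear (φ := φ) res Λ) :
    kerParabolic b φ →+ parabolicLie (κ := κ) b where
  toFun X := ⟨(X : Matrix n n B).map Λ, by
    rw [mem_parabolicLie_iff]
    intro i j hij
    rw [Matrix.map_apply, X.2.2 hij, hΛ.map_zero]⟩
  map_zero' := Subtype.ext (by
    ext i j
    simp [hΛ.map_zero])
  map_add' X Y := Subtype.ext (by
    ext i j
    simp only [AddSubgroup.coe_add, Matrix.map_apply, Matrix.add_apply, Submodule.coe_add]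
    exact hΛ.map_add _ _ ((RingHom.mem_ker).mpr ((mem_kerMatrix_iff _).mp X.2.1 i j))
      ((RingHom.mem_ker).mpr ((mem_kerMatrix_iff _).mp Y.2.1 i j)))

/-- `kernelEntrywise` on elements. [folklore] -/
@[simp] theorem coe_kernelEntrywise_apply (hΛ : IsKernelSemilinear (φ := φ) res Λ)
    (X : kerParabolic b φ) :
    ((kernelEntrywise b hΛ X : parabolicLie (κ := κ) b) : Matrix n n κ) = (X : Matrix n n B).map Λ :=
  rfl

/-- **Additivity of the entrywise map in the functional**: if `Λ₊ = Λ + Λ'` pointwise then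
`kernelEntrywise Λ₊ = kernelEntrywise Λ + kernelEntrywise Λ'`. [cite: Mazur1989Deforming, §1.6 Prop. 2] -/
theorem kernelEntrywise_add {Λ' Λs : B → κ} (hΛ : IsKernelSemilinear (φ := φ) res Λ)
    (hΛ' : IsKernelSemilinear (φ := φ) res Λ') (hΛs : IsKernelSemilinear (φ := φ) res Λs)
    (h : ∀ x, Λs x = Λ x + Λ' x) :
    kernelEntrywise b hΛs = kernelEntrywise b hΛ + kernelEntrywise b hΛ' := by
  refine AddMonoidHom.ext fun X => Subtype.ext ?_
  change (X : Matrix n n B).map Λs = (X : Matrix n n B).map Λ + (X : Matrix n n B).map Λ'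
  ext i j
  simp only [Matrix.map_apply, Matrix.add_apply, h]

/-- **Homogeneity of the entrywise map in the functional**: if `Λ_c = c · Λ` pointwise then
`kernelEntrywise Λ_c = c • kernelEntrywise Λ`. [folklore] -/
theorem kernelEntrywise_smul {Λc : B → κ} (c : κ) (hΛ : IsKernelSemilinear (φ := φ) res Λ)
    (hΛc : IsKernelSemilinear (φ := φ) res Λc) (h : ∀ x, Λc x = c * Λ x) :
    kernelEntrywise b hΛc = c • kernelEntrywise b hΛ := by
  refine AddMonoidHom.ext fun X => Subtype.ext ?_
  change (X : Matrix n n B).map Λc = c • (X : Matrix n n B).map Λ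
  ext i j
  simp only [Matrix.map_apply, Matrix.smul_apply, smul_eq_mul, h]

variable [TopologicalSpace κ] [DiscreteTopology κ] {G : Type v} [Group G] [TopologicalSpace G]
  [IsTopologicalGroup G] {s : GL n A → GL n B}
  (hsP : ∀ g ∈ parabolicGL b A, s g ∈ parabolicGL b B)
  (ρ : G →* GL n A) (hρP : ∀ σ, ρ σ ∈ parabolicGL b A)
  (r : G →* GL n κ) (hr : IsOpen ((r.ker : Subgroup G) : Set G))
  (hrP : ∀ σ, r σ ∈ parabolicGL b κ)
  (hsr : ∀ σ, Matrix.GeneralLinearGroup.map res (s (ρ σ)) = r σ)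

include hsr in
/-- **The entrywise coefficient map is conjugation-equivariant** when the section reduces to
`r` (`GL_n(res)(s(ρσ)) = r(σ)`): `Λ(s(ρσ) X s(ρσ)⁻¹) = r(σ) Λ(X) r(σ)⁻¹`.
[cite: Mazur1989Deforming, §1.6 Prop. 2] -/
theorem isConjEquivariant_kernelEntrywise (hΛ : IsKernelSemilinear (φ := φ) res Λ) :
    IsConjEquivariant b hsP ρ hρP (adParabolicRep r hr b hrP).toTopRep (kernelEntrywise b hΛ) := by
  intro σ X
  refine Subtype.ext ?_
  change ((s (ρ σ) : Matrix n n B) * (X : Matrix n n B) * ((s (ρ σ))⁻¹ : GL n B)).map Λ =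
    (r σ : Matrix n n κ) * (X : Matrix n n B).map Λ * (((r σ)⁻¹ : GL n κ) : Matrix n n κ)
  rw [map_mul_mul_of_kernelSemilinear hΛ _ _ X.2.1, ← hsr σ, ← map_inv]
  rfl

end Entrywise

end LiftingObstruction

end Literature.NumberTheory.GaloisRepresentations
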